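import Summits.CriticalPhenomena.CardyFormulaZ2.Theses.CardyMagicRigidity
import Literature.Probability.Percolation.CardyFormulaConformalInvariance
import Literature.Probability.Percolation.BoxCrossingUpperBound
import Literature.Probability.Percolation.ZdNearCriticalWindow
import Literature.Probability.Percolation.HalfSpacePinnedPairs
import Literature.Probability.Percolation.SharpnessDCTProofs
import Literature.Probability.RandomPlanarGeometry.ConformalRectangleProofs
import Literature.Probability.RandomPlanarGeometry.CrossRatioContinuity
import Literature.Probability.RandomPlanarGeometry.CardyFunction

/-!
# Line `oracle-sandwich`, stub D1: continuity of the Cardy value along uniformly close marked loops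

Crux `LoopsToCrossings` (stmt-CriticalPhenomena-4837) of route `CardyMagicRigidity`, line
`oracle-sandwich` (`Cruxes/LoopsToCrossings/Lines/oracle-sandwich.lean`), registered stub
`stub_cardyContinuity` (pure complex analysis, `X`-free): for every conformal rectangle `R` with
uniformizing datum `(φ, x)` and every `τ > 0` there is `ε₀ > 0` such that every conformal
rectangle `Q` whose boundary loop is uniformly `ε₀`-close to that of `R` and whose marks are
`ε₀`-close to those of `R` has Cardy value `F(η_Q)` within `τ` of `F(η_R)`, for EVERY uniformizing
datum of `Q`.

Proof: by contradiction, offending rectangles `Q_n` at closeness `1/(n+1)` have boundary loops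
converging uniformly to `R.boundary` and marks converging to `R.mark`, so by the continuity of
the conformal modulus (`ConformalRectangle.tendsto_crossRatio_of_tendsto_mark`,
`Literature/Probability/RandomPlanarGeometry/CrossRatioContinuity.lean` — Radó's theorem,
Pommerenke (1992) Thm. 2.11, PROVED in the tree as `JordanDomain.rado_tendstoUniformlyOn_holds`)
their cross-ratios converge to `η_R ∈ (0, 1)`, where Cardy's function is continuous
(`continuousOn_cardyFunction_Ioo`); contradiction.

## References

* Ch. Pommerenke, *Boundary Behaviour of Conformal Maps* (1992), §2.3 Thm. 2.11, Cor. 2.4.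
* J. L. Cardy, *Critical percolation in finite geometries*, J. Phys. A 25 (1992) L201.
-/

noncomputable section

namespace Summit.CriticalPhenomena.CardyFormulaZ2.Cruxes.LoopsToCrossings.OracleSandwich

open Summit.CriticalPhenomena.CardyFormulaZ2.Theses.CardyMagicRigidity
open Literature.Probability.RandomPlanarGeometry hiding cardyFunction
open Literature.Probability.Percolation hiding cardyFunction
open Literature.Probability.LatticeModels
open Filter Topology Set MeasureTheory Metric

/-- **Stub D1 — continuity of the Cardy value along uniformly close marked loops** (pure complex
analysis, X-free).  For every conformal rectangle `R` with uniformizing datum `(φ, x)` and every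
`τ > 0` there is `ε₀ > 0` such that every conformal rectangle `Q` whose boundary loop is uniformly
`ε₀`-close to that of `R` (`dist (Q.boundary u) (R.boundary u) ≤ ε₀` for all `u`) and whose marks
are `ε₀`-close to those of `R` has Cardy value within `τ` of `R`'s, for EVERY uniformizing datum of
`Q`.
Proof by contradiction: offending `Q_n` at closeness `1/(n+1)` converge to `R` (uniformly as
parametrised loops, marks converging), so their cross-ratios converge to `η_R` by the continuity
of the conformal modulus (`ConformalRectangle.tendsto_crossRatio_of_tendsto_mark`, from Radó's
theorem `JordanDomain.rado_tendstoUniformlyOn_holds`, Pommerenke (1992) Thm. 2.11), and `F` is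
continuous at `η_R ∈ (0, 1)` (`continuousOn_cardyFunction_Ioo`).
[cite: PommerenkeBBCM1992, Thm. 2.11 and Cor. 2.4] -/
theorem stub_cardyContinuity :
    ∀ (R : ConformalRectangle) (φ : ConformalEquiv UpperHalfPlane.upperHalfPlaneSet R.carrier)
      (x : Fin 4 → ℝ), R.IsUniformizing φ x → ∀ τ : ℝ, 0 < τ → ∃ ε₀ : ℝ, 0 < ε₀ ∧
      ∀ (Q : ConformalRectangle), (∀ u : ℝ, dist (Q.boundary u) (R.boundary u) ≤ ε₀) →
        (∀ i : Fin 4, |Q.mark i - R.mark i| ≤ ε₀) →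
        ∀ (ψ : ConformalEquiv UpperHalfPlane.upperHalfPlaneSet Q.carrier) (y : Fin 4 → ℝ),
          Q.IsUniformizing ψ y →
          |Literature.Probability.RandomPlanarGeometry.cardyFunction (crossRatio y) -
            Literature.Probability.RandomPlanarGeometry.cardyFunction (crossRatio x)| ≤ τ := by
  intro R φ x hφ τ hτ
  by_contra hcon
  push Not at hcon
  -- offending rectangles at closeness `1/(n+1)`
  have hseq : ∀ n : ℕ, ∃ Q : ConformalRectangle,
      (∀ u : ℝ, dist (Q.boundary u) (R.boundary u) ≤ 1 / ((n : ℝ) + 1)) ∧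
      (∀ i : Fin 4, |Q.mark i - R.mark i| ≤ 1 / ((n : ℝ) + 1)) ∧
      ∃ (ψ : ConformalEquiv UpperHalfPlane.upperHalfPlaneSet Q.carrier) (y : Fin 4 → ℝ),
        Q.IsUniformizing ψ y ∧
        τ < |Literature.Probability.RandomPlanarGeometry.cardyFunction (crossRatio y) -
          Literature.Probability.RandomPlanarGeometry.cardyFunction (crossRatio x)| :=
    fun n ↦ hcon _ (by positivity)
  choose Q hQb hQm ψ y hψ hbad using hseq
  have hsmall : ∀ ε : ℝ, 0 < ε → ∀ᶠ n : ℕ in atTop, 1 / ((n : ℝ) + 1) < ε := fun ε hε ↦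
    (tendsto_order.1 tendsto_one_div_add_atTop_nhds_zero_nat).2 ε hε
  -- the boundary loops converge uniformly and the marks converge
  have hJ : TendstoUniformly (fun n ↦ (Q n).boundary) R.boundary atTop := by
    rw [Metric.tendstoUniformly_iff]
    intro ε hε
    filter_upwards [hsmall ε hε] with n hn u
    rw [dist_comm]
    exact (hQb n u).trans_lt hn
  have hm : ∀ i, Tendsto (fun n ↦ (Q n).mark i) atTop (𝓝 (R.mark i)) := fun i ↦ by
    rw [Metric.tendsto_nhds]
    intro ε hε
    filter_upwards [hsmall ε hε] with n hn
    rw [Real.dist_eq]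
    exact (hQm n i).trans_lt hn
  -- hence the cross-ratios converge (Radó), and so do the Cardy values
  have hlim : Tendsto (fun n ↦ crossRatio (y n)) atTop (𝓝 (crossRatio x)) :=
    ConformalRectangle.tendsto_crossRatio_of_tendsto_mark hJ hm ψ y hψ φ x hφ
  have hF : ContinuousAt Literature.Probability.RandomPlanarGeometry.cardyFunction (crossRatio x) :=
    continuousOn_cardyFunction_Ioo.continuousAt
      (isOpen_Ioo.mem_nhds (ConformalRectangle.crossRatio_mem_Ioo_of_isUniformizing hφ))
  have hFlim := hF.tendsto.comp hlim
  obtain ⟨n, hn⟩ := (Metric.tendsto_nhds.1 hFlim τ hτ).exists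
  rw [Function.comp_apply, Real.dist_eq] at hn
  exact absurd hn (not_lt.2 (hbad n).le)

end Summit.CriticalPhenomena.CardyFormulaZ2.Cruxes.LoopsToCrossings.OracleSandwich
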